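import Mathlib.Analysis.MeanInequalities
import Literature.MathematicalPhysics.QuantumLattice.HeisenbergModel
import Literature.Probability.LatticeModels.LatticeGraph

/-!
# Route `AnisotropyChord` / H0 rotor rung: the ENTROPY ROUTE to condensation — Bhattacharyya–Jensen
# floor, THEOREM E-FLOOR (proved), and the crux `InsertionEntropyBound` TYPED with its proved link to
# eventual condensation (theory seat memo ROTOR-THEORY-7 §82–§86, PORT-SPEC P-9; definitions + proofs)

Typing authority: THEORY seat `hubbard-h0-rotor-theory-1`, cycle 7, memo ROTOR-THEORY-7 §82–§86; this file
is `Sketch7.lean` Parts A–C transplanted verbatim up to namespace and docstring tags.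

Hard-core bosons on a finite vertex set `V` = spin ½ (`TensorIndex V 2 = V → Fin 2`; particle at `x` ⇔
`σ x = 0`, so `b†_x = S⁺_x`, `b_x = S⁻_x`, `N = |V|/2 + Sᶻ_tot`).  A stoquastic sector ground state has
entrywise non-negative amplitudes `a : (V → Fin 2) → ℝ`; everything is stated on real amplitude functions.

* Part A — `klDiv` (Kullback–Leibler), `bhatt` (Bhattacharyya coefficient), **LEMMA J**
  `bhatt_ge_exp_neg_half_klDiv`: `BC(p,q) ≥ exp(−KL(p‖q)/2)` (weighted AM–GM).
* Part B — `lowerSum` (`S⁻_tot ψ`), `lowerNormSq`, `condensateDensity` (`n₀/|V| = |V|⁻²‖S⁻_tot ψ‖²`),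
  `towerSum`, `siteTower` (`m_x = ⟨ψ_{N−1}, b_x ψ_N⟩`), `siteDensity`, `holeLaw` (`ν_x`), `bornLaw` (`π`);
  **LEMMA T** `siteTower_eq` (`m_x = √ρ_x · BC(ν_x, π)`), `towerSum_sq_le` (Cauchy–Schwarz tower floor),
  **THEOREM E-FLOOR** `condensateDensity_ge_of_entropy`: `n₀/|V| ≥ ρ · exp(−sup_x KL(ν_x ‖ π))` — no
  Hamiltonian, no dimension.
* Part C — the crux **CONJECTURE E** `InsertionEntropyBound Δ M` (OPEN; RPA insertion-entropy law,
  ED-verified on 59 tori/rings) in the tree's currency (`xxzHamiltonian 1 (torusGraph 2 L) (−1) Δ`,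
  `spinZSector`, `lowestEnergyInSector`; `IsPerronSectorGroundAmplitude`), the support statements
  `UniformSiteDensity`, `PerronSectorExists`, the target-side `EventualCondensate`, the **LINK (PROVED)**
  `eventualCondensate_of_insertionEntropyBound`, and the typed records `InsertionEntropyMonotone`
  (ENT-VT) and `RingInsertionEntropyDiverges` (d = 1 negative side).

Bears on H0 («uniform transverse stiffness + compressibility ⇒ ODLRO», the implication itself): E-FLOOR
replaces the exhaustion step of the cycle-1 Landau layer by a multiplicative handle; the crux E is what a
proof of H0 along this route must supply.  Nothing here claims E.  References: theory seat memo
ROTOR-THEORY-7; A. Bhattacharyya (1943); S. Kullback, R. Leibler (1951); L. Pitaevskii, S. Stringari,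
J. Low Temp. Phys. 85 (1991) (sum-rule bounds, cf. Griffin–Snoke–Stringari (eds.), *Bose–Einstein
Condensation* (1995) p. 74, 79).
-/

set_option linter.dupNamespace false

noncomputable section

open Matrix Finset Real Filter Topology
open Literature.MathematicalPhysics.QuantumLattice Literature.Probability.LatticeModels

namespace Summit.HubbardSuperconductivity.HubbardSuperconductivity.Theorems.AnisotropyChord.InsertionEntropy

/-! ## A. Finite relative entropy and the Bhattacharyya–Jensen floor -/

section Entropy

variable {ι : Type*} [Fintype ι]

/-- Kullback–Leibler divergence `KL(p‖q) = Σ p log(p/q)` of finitely supported weight functions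
(meaningful when `p ≪ q`; `Real.log 0 = 0` otherwise produces junk). [folklore] -/
def klDiv (p q : ι → ℝ) : ℝ := ∑ i, p i * Real.log (p i / q i)

/-- Bhattacharyya coefficient `BC(p,q) = Σ √(p q)`. [folklore] -/
def bhatt (p q : ι → ℝ) : ℝ := ∑ i, Real.sqrt (p i * q i)

/-- The Bhattacharyya coefficient is non-negative. [folklore] -/
theorem bhatt_nonneg (p q : ι → ℝ) : 0 ≤ bhatt p q :=
  Finset.sum_nonneg fun _ _ => Real.sqrt_nonneg _

/-- **LEMMA J.** `BC(p,q) ≥ exp(−KL(p‖q)/2)` (Jensen / weighted AM–GM with weights `p`; the absolute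
continuity hypothesis `hac` is load-bearing since `Real.log 0 = 0`). Theory seat memo ROTOR-THEORY-7 §83. [folklore] -/
theorem bhatt_ge_exp_neg_half_klDiv (p q : ι → ℝ) (hp : ∀ i, 0 ≤ p i) (hp1 : ∑ i, p i = 1)
    (hac : ∀ i, 0 < p i → 0 < q i) :
    Real.exp (-(klDiv p q) / 2) ≤ bhatt p q := by
  classical
  set s : Finset ι := univ.filter (fun i => p i ≠ 0) with hs
  have hmem : ∀ i, i ∈ s ↔ p i ≠ 0 := by intro i; simp [hs]
  have hpos : ∀ i ∈ s, 0 < p i := fun i hi => lt_of_le_of_ne (hp i) (Ne.symm ((hmem i).mp hi))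
  have hqpos : ∀ i ∈ s, 0 < q i := fun i hi => hac i (hpos i hi)
  have hoff : ∀ i, i ∉ s → p i = 0 := by
    intro i hi; by_contra h; exact hi ((hmem i).mpr h)
  have hw1 : ∑ i ∈ s, p i = 1 := by rw [hs, Finset.sum_filter_ne_zero]; exact hp1
  set z : ι → ℝ := fun i => Real.sqrt (q i / p i) with hz
  have hzpos : ∀ i ∈ s, 0 < z i := fun i hi => Real.sqrt_pos.mpr (div_pos (hqpos i hi) (hpos i hi))
  have key := Real.geom_mean_le_arith_mean_weighted s p z (fun i _ => hp i) hw1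
    (fun i _ => Real.sqrt_nonneg _)
  -- left-hand side of AM-GM = exp(-KL/2)
  have hL : ∏ i ∈ s, z i ^ p i = Real.exp (-(klDiv p q) / 2) := by
    have h1 : ∏ i ∈ s, z i ^ p i = ∏ i ∈ s, Real.exp (Real.log (z i) * p i) :=
      Finset.prod_congr rfl fun i hi => Real.rpow_def_of_pos (hzpos i hi) _
    rw [h1, ← Real.exp_sum]
    congr 1
    have h2 : klDiv p q = ∑ i ∈ s, p i * Real.log (p i / q i) := by
      unfold klDiv
      exact (Finset.sum_subset (Finset.subset_univ s) (fun i _ hi => by simp [hoff i hi])).symm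
    rw [h2]
    have h3 : ∀ i ∈ s, Real.log (z i) * p i = -(p i * Real.log (p i / q i)) / 2 := by
      intro i hi
      have hpi := hpos i hi
      have hqi := hqpos i hi
      rw [hz]
      simp only
      rw [Real.log_sqrt (le_of_lt (div_pos hqi hpi)), Real.log_div (ne_of_gt hqi) (ne_of_gt hpi),
        Real.log_div (ne_of_gt hpi) (ne_of_gt hqi)]
      ring
    rw [Finset.sum_congr rfl h3, ← Finset.sum_div, Finset.sum_neg_distrib]
  -- right-hand side of AM-GM ≤ BC
  have hR : ∑ i ∈ s, p i * z i ≤ bhatt p q := by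
    have h1 : ∑ i ∈ s, p i * z i = ∑ i ∈ s, Real.sqrt (p i * q i) := by
      refine Finset.sum_congr rfl fun i hi => ?_
      have hpi := hpos i hi
      rw [hz]
      simp only
      rw [← Real.sqrt_sq (le_of_lt hpi), ← Real.sqrt_mul (sq_nonneg _), Real.sqrt_sq (le_of_lt hpi)]
      congr 1
      field_simp
    rw [h1]
    exact Finset.sum_le_univ_sum_of_nonneg fun i => Real.sqrt_nonneg _
  calc Real.exp (-(klDiv p q) / 2) = ∏ i ∈ s, z i ^ p i := hL.symm
    _ ≤ ∑ i ∈ s, p i * z i := key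
    _ ≤ bhatt p q := hR

end Entropy

/-! ## B. Hard-core boson amplitudes: tower overlap, hole laws, condensate density -/

section Lattice

variable {V : Type} [Fintype V] [DecidableEq V]

/-- `(S⁻_tot ψ)(τ) = Σ_{x : τ x = 1} ψ(τ with x ↦ 0)` on real amplitudes (`b_x = S⁻_x` removes the
particle at `x`; particle ⇔ `σ x = 0`). (theory seat `hubbard-h0-rotor-theory-1`, memo ROTOR-THEORY-7 §82–§83) [folklore] -/
def lowerSum (a : (V → Fin 2) → ℝ) (τ : V → Fin 2) : ℝ :=
  ∑ x, if τ x = 1 then a (Function.update τ x 0) else 0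

/-- `‖S⁻_tot ψ‖² = Σ_{x,y} ⟨ψ, S⁺_x S⁻_y ψ⟩ = |V| · N₀`. (theory seat `hubbard-h0-rotor-theory-1`, memo ROTOR-THEORY-7 §82–§83) [folklore] -/
def lowerNormSq (a : (V → Fin 2) → ℝ) : ℝ := ∑ τ, lowerSum a τ ^ 2

/-- Condensate (ODLRO) density `n₀/|V| = |V|⁻² ‖S⁻_tot ψ‖²`. (theory seat `hubbard-h0-rotor-theory-1`, memo ROTOR-THEORY-7 §82–§83) [folklore] -/
def condensateDensity (a : (V → Fin 2) → ℝ) : ℝ := lowerNormSq a / (Fintype.card V : ℝ) ^ 2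

/-- Tower transition element `⟨ψ_{N−1}, S⁻_tot ψ_N⟩`. (theory seat `hubbard-h0-rotor-theory-1`, memo ROTOR-THEORY-7 §82–§83) [folklore] -/
def towerSum (aM aN : (V → Fin 2) → ℝ) : ℝ := ∑ τ, aM τ * lowerSum aN τ

/-- Site tower amplitude `m_x = ⟨ψ_{N−1}, b_x ψ_N⟩ = Σ_{τ : τ x = 1} ψ_{N−1}(τ) ψ_N(τ + x)`. (theory seat `hubbard-h0-rotor-theory-1`, memo ROTOR-THEORY-7 §82–§83) [folklore] -/
def siteTower (aM aN : (V → Fin 2) → ℝ) (x : V) : ℝ :=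
  ∑ τ, if τ x = 1 then aM τ * aN (Function.update τ x 0) else 0

/-- Site density `ρ_x = ⟨n_x⟩ = Σ_{σ : σ x = 0} ψ_N(σ)²`. (theory seat `hubbard-h0-rotor-theory-1`, memo ROTOR-THEORY-7 §82–§83) [folklore] -/
def siteDensity (aN : (V → Fin 2) → ℝ) (x : V) : ℝ := ∑ σ, if σ x = 0 then aN σ ^ 2 else 0

/-- The HOLE-CONDITIONED INSERTION LAW `ν_x(τ) = ψ_N(τ + x)²/ρ_x` on configurations `τ` with `x`
empty: the law of the other `N − 1` particles given a particle at `x`. (theory seat `hubbard-h0-rotor-theory-1`, memo ROTOR-THEORY-7 §82–§83) [folklore] -/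
def holeLaw (aN : (V → Fin 2) → ℝ) (x : V) (τ : V → Fin 2) : ℝ :=
  if τ x = 1 then aN (Function.update τ x 0) ^ 2 / siteDensity aN x else 0

/-- Born law `π(τ) = ψ(τ)²`. (theory seat `hubbard-h0-rotor-theory-1`, memo ROTOR-THEORY-7 §82–§83) [folklore] -/
def bornLaw (aM : (V → Fin 2) → ℝ) (τ : V → Fin 2) : ℝ := aM τ ^ 2

/-- `⟨ψ_{N−1}, S⁻_tot ψ_N⟩ = Σ_x m_x`. Theory seat memo ROTOR-THEORY-7 §83. [folklore] -/
theorem towerSum_eq_sum_siteTower (aM aN : (V → Fin 2) → ℝ) :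
    towerSum aM aN = ∑ x, siteTower aM aN x := by
  unfold towerSum siteTower lowerSum
  rw [Finset.sum_comm]
  refine Finset.sum_congr rfl fun τ _ => ?_
  rw [Finset.mul_sum]
  refine Finset.sum_congr rfl fun x _ => ?_
  split_ifs <;> simp

/-- Cauchy–Schwarz tower floor: `⟨ψ_{N−1}, S⁻_tot ψ_N⟩² ≤ ‖ψ_{N−1}‖² ‖S⁻_tot ψ_N‖²`. Theory seat memo ROTOR-THEORY-7 §83. [folklore] -/
theorem towerSum_sq_le (aM aN : (V → Fin 2) → ℝ) :
    towerSum aM aN ^ 2 ≤ (∑ τ, aM τ ^ 2) * lowerNormSq aN := by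
  unfold towerSum lowerNormSq
  exact Finset.sum_mul_sq_le_sq_mul_sq univ aM (lowerSum aN)

/-- **LEMMA T.** `m_x = √ρ_x · BC(ν_x, π)` for non-negative amplitudes. Theory seat memo ROTOR-THEORY-7 §83. [folklore] -/
theorem siteTower_eq (aM aN : (V → Fin 2) → ℝ) (x : V) (hM : ∀ τ, 0 ≤ aM τ) (hN : ∀ σ, 0 ≤ aN σ)
    (hρ : 0 < siteDensity aN x) :
    siteTower aM aN x = Real.sqrt (siteDensity aN x) * bhatt (holeLaw aN x) (bornLaw aM) := by
  unfold siteTower bhatt holeLaw bornLaw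
  rw [Finset.mul_sum]
  refine Finset.sum_congr rfl fun τ _ => ?_
  set ρ := siteDensity aN x with hρdef
  split_ifs with h
  · have hu := hN (Function.update τ x 0)
    have hv := hM τ
    have hsρ : Real.sqrt ρ ≠ 0 := ne_of_gt (Real.sqrt_pos.mpr hρ)
    have e1 : aN (Function.update τ x 0) ^ 2 / ρ * aM τ ^ 2
        = (aN (Function.update τ x 0) * aM τ) ^ 2 / ρ := by ring
    rw [e1, Real.sqrt_div (sq_nonneg _), Real.sqrt_sq (mul_nonneg hu hv), mul_div_assoc']
    rw [mul_div_cancel_left₀ _ hsρ]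
    ring
  · simp

/-- The hole law is a probability law when `ρ_x > 0`. Theory seat memo ROTOR-THEORY-7 §82. [folklore] -/
theorem sum_holeLaw (aN : (V → Fin 2) → ℝ) (x : V) (hρ : 0 < siteDensity aN x) :
    ∑ τ, holeLaw aN x τ = 1 := by
  unfold holeLaw
  have hρ' : siteDensity aN x ≠ 0 := ne_of_gt hρ
  -- reindex the configurations with `x` empty by those with `x` occupied
  have key : ∑ τ : V → Fin 2, (if τ x = 1 then aN (Function.update τ x 0) ^ 2 else 0)
      = ∑ σ : V → Fin 2, (if σ x = 0 then aN σ ^ 2 else 0) := by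
    rw [← Finset.sum_filter, ← Finset.sum_filter]
    refine Finset.sum_bij' (fun τ _ => Function.update τ x 0) (fun σ _ => Function.update σ x 1)
      ?_ ?_ ?_ ?_ ?_
    · intro τ hτ; simp
    · intro σ hσ; simp
    · intro τ hτ
      simp only [Finset.mem_filter, Finset.mem_univ, true_and] at hτ
      rw [Function.update_idem, ← hτ, Function.update_eq_self]
    · intro σ hσ
      simp only [Finset.mem_filter, Finset.mem_univ, true_and] at hσ
      rw [Function.update_idem, ← hσ, Function.update_eq_self]
    · intro τ hτ; rfl
  have h2 : ∑ τ : V → Fin 2, (if τ x = 1 then aN (Function.update τ x 0) ^ 2 / siteDensity aN x else 0)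
      = (∑ τ : V → Fin 2, (if τ x = 1 then aN (Function.update τ x 0) ^ 2 else 0)) / siteDensity aN x := by
    rw [Finset.sum_div]
    refine Finset.sum_congr rfl fun τ _ => ?_
    split_ifs <;> simp
  rw [h2, key]
  unfold siteDensity at hρ' ⊢
  exact div_self hρ'

/-- The hole law is non-negative. [folklore] -/
theorem holeLaw_nonneg (aN : (V → Fin 2) → ℝ) (x : V) (hρ : 0 < siteDensity aN x) (τ : V → Fin 2) :
    0 ≤ holeLaw aN x τ := by
  unfold holeLaw
  split_ifs
  · exact div_nonneg (sq_nonneg _) (le_of_lt hρ)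
  · exact le_rfl

/-- **THEOREM E-FLOOR** (universal entropy floor on the condensate density).  For non-negative
amplitudes `aN` with uniform site density `ρ > 0`, a unit non-negative reference `aM` with `ν_x ≪ π_M`
for every `x`, and `K ≥ sup_x KL(ν_x ‖ π_M)`:  `n₀/|V| ≥ ρ · e^{−K}`. (theory seat `hubbard-h0-rotor-theory-1`, memo ROTOR-THEORY-7 §82–§83) [folklore] -/
theorem condensateDensity_ge_of_entropy [Nonempty V] (aM aN : (V → Fin 2) → ℝ) (ρ K : ℝ)
    (hρ : 0 < ρ) (hM : ∀ τ, 0 ≤ aM τ) (hN : ∀ σ, 0 ≤ aN σ) (hM1 : ∑ τ, aM τ ^ 2 = 1)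
    (hdens : ∀ x, siteDensity aN x = ρ)
    (hac : ∀ x τ, 0 < holeLaw aN x τ → 0 < bornLaw aM τ)
    (hK : ∀ x, klDiv (holeLaw aN x) (bornLaw aM) ≤ K) :
    ρ * Real.exp (-K) ≤ condensateDensity aN := by
  have hρx : ∀ x, 0 < siteDensity aN x := fun x => by rw [hdens x]; exact hρ
  -- per-site floor on the tower amplitude
  have hm : ∀ x, Real.sqrt ρ * Real.exp (-K / 2) ≤ siteTower aM aN x := by
    intro x
    have hJ := bhatt_ge_exp_neg_half_klDiv (holeLaw aN x) (bornLaw aM) (holeLaw_nonneg aN x (hρx x))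
      (sum_holeLaw aN x (hρx x)) (hac x)
    rw [siteTower_eq aM aN x hM hN (hρx x), hdens x]
    refine mul_le_mul_of_nonneg_left (le_trans ?_ hJ) (Real.sqrt_nonneg _)
    exact Real.exp_le_exp.mpr (by linarith [hK x])
  -- sum over sites
  have hsum : (Fintype.card V : ℝ) * (Real.sqrt ρ * Real.exp (-K / 2)) ≤ towerSum aM aN := by
    rw [towerSum_eq_sum_siteTower]
    have := Finset.card_nsmul_le_sum (univ : Finset V) (fun x => siteTower aM aN x)
      (Real.sqrt ρ * Real.exp (-K / 2)) (fun x _ => hm x)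
    simpa [nsmul_eq_mul] using this
  have hpos : 0 ≤ (Fintype.card V : ℝ) * (Real.sqrt ρ * Real.exp (-K / 2)) := by positivity
  have hsq : ((Fintype.card V : ℝ) * (Real.sqrt ρ * Real.exp (-K / 2))) ^ 2 ≤ lowerNormSq aN := by
    calc ((Fintype.card V : ℝ) * (Real.sqrt ρ * Real.exp (-K / 2))) ^ 2 ≤ towerSum aM aN ^ 2 :=
          pow_le_pow_left₀ hpos hsum 2
      _ ≤ (∑ τ, aM τ ^ 2) * lowerNormSq aN := towerSum_sq_le aM aN
      _ = lowerNormSq aN := by rw [hM1, one_mul]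
  have hexp : Real.exp (-K / 2) ^ 2 = Real.exp (-K) := by
    rw [sq, ← Real.exp_add]; ring_nf
  have hcard : (0 : ℝ) < (Fintype.card V : ℝ) := by exact_mod_cast Fintype.card_pos
  unfold condensateDensity
  rw [le_div_iff₀ (by positivity)]
  calc ρ * Real.exp (-K) * (Fintype.card V : ℝ) ^ 2
        = ((Fintype.card V : ℝ) * (Real.sqrt ρ * Real.exp (-K / 2))) ^ 2 := by
          rw [mul_pow, mul_pow, Real.sq_sqrt (le_of_lt hρ), hexp]; ring
    _ ≤ lowerNormSq aN := hsq

end Lattice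

/-! ## C. The crux in the tree's currency and the link to condensation -/

section Crux

/-- `a` is the (real, non-negative) amplitude function of a normalised sector ground state of the
n.n. hard-core boson / XXZ torus Hamiltonian `H(Δ) = xxzHamiltonian 1 (torusGraph 2 L) (-1) Δ` in the
sector `Sᶻ_tot = M` (`N = L²/2 + M` particles), strictly positive on the sector (Perron–Frobenius
sign choice; `H(Δ)` is stoquastic in the `Sᶻ` basis for every `Δ`). Theory seat memo ROTOR-THEORY-7 §82. [folklore] -/
structure IsPerronSectorGroundAmplitude (L : ℕ) [NeZero L] (Δ M : ℝ)
    (a : TensorIndex (TorusSite 2 L) 2 → ℝ) : Prop where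
  nonneg : ∀ σ, 0 ≤ a σ
  sector : (fun σ => (a σ : ℂ)) ∈ spinZSector (Λ := TorusSite 2 L) 1 M
  unit : ∑ σ, a σ ^ 2 = 1
  eigen : (xxzHamiltonian 1 (torusGraph 2 L) (-1) Δ).mulVec (fun σ => (a σ : ℂ))
      = ((lowestEnergyInSector 1 (xxzHamiltonian 1 (torusGraph 2 L) (-1) Δ) M : ℝ) : ℂ)
          • (fun σ => (a σ : ℂ))

/-- **CONJECTURE E — `InsertionEntropyBound` (the crux of the entropy route; OPEN).**  Along the
sector sequence `M L` there is `K` such that, eventually in `L`, for every Perron sector ground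
amplitude `aN` (sector `M L`) and `aM` (sector `M L − 1`) of `H(Δ)` and every site `x`:
`ν_x[aN] ≪ π[aM]` and `KL(ν_x[aN] ‖ π[aM]) ≤ K`.
Heuristic value (RPA insertion-entropy law, memo §83): `K ≈ (2ρ)⁻¹ (2π)⁻² ∫_{BZ} S(k)⁻¹ (1 − S(k)/S₀)² d²k`,
finite iff `∫ d²k / S(k) < ∞`, which (S)+(K)+Feynman–Landau give (`S(k) ≥ c|k|`).  FALSE in `d = 1`
(ED: `KL_int` grows like `0.6 log L` on rings) and in solids (`KL ~ |x − y|`).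
[conjecture: theory seat hubbard-h0-rotor-theory-1, cycle 7, 2026-08-28 — memo ROTOR-THEORY-7 §84; OPEN] -/
def InsertionEntropyBound (Δ : ℝ) (M : ℕ → ℝ) : Prop :=
  ∃ K : ℝ, ∀ᶠ L : ℕ in atTop, ∀ [NeZero L],
    ∀ aN aM : TensorIndex (TorusSite 2 L) 2 → ℝ,
      IsPerronSectorGroundAmplitude L Δ (M L) aN → IsPerronSectorGroundAmplitude L Δ (M L - 1) aM →
        ∀ x : TorusSite 2 L,
          (∀ τ, 0 < holeLaw aN x τ → 0 < bornLaw aM τ) ∧ klDiv (holeLaw aN x) (bornLaw aM) ≤ K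

/-- Uniform site density of sector states on the torus (translation covariance of the Perron vector:
`⟨n_x⟩ = N/|Λ|` for every `x`).  Provable (uniqueness of the Perron vector + translation invariance of
`H(Δ)`); kept as a named support statement.
[conjecture: theory seat hubbard-h0-rotor-theory-1, cycle 7, 2026-08-28 — memo ROTOR-THEORY-7 §84 support statement (provable: Perron uniqueness + translation covariance)] -/
def UniformSiteDensity (Δ : ℝ) (M : ℕ → ℝ) : Prop :=
  ∀ᶠ L : ℕ in atTop, ∀ [NeZero L], ∀ aN : TensorIndex (TorusSite 2 L) 2 → ℝ,
    IsPerronSectorGroundAmplitude L Δ (M L) aN →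
      ∀ x : TorusSite 2 L, siteDensity aN x = 1 / 2 + M L / ((L : ℝ) ^ 2)

/-- Existence of the adjacent Perron sector ground amplitude (stoquasticity + Perron–Frobenius on the
connected sector graph, `0 < N − 1`). Support statement.
[conjecture: theory seat hubbard-h0-rotor-theory-1, cycle 7, 2026-08-28 — memo ROTOR-THEORY-7 §84 support statement (provable: sector Perron–Frobenius)] -/
def PerronSectorExists (Δ : ℝ) (M : ℕ → ℝ) : Prop :=
  ∀ᶠ L : ℕ in atTop, ∀ [NeZero L], ∃ aM : TensorIndex (TorusSite 2 L) 2 → ℝ,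
    IsPerronSectorGroundAmplitude L Δ (M L - 1) aM

/-- Classical-side eventual ODLRO: a uniform floor on the condensate density of every Perron sector
ground amplitude, eventually in `L` (the conclusion of H0 in the rotor class, classical-side form).
[conjecture: theory seat hubbard-h0-rotor-theory-1, cycle 7, 2026-08-28 — memo ROTOR-THEORY-7 §84 (target-side statement)] -/
def EventualCondensate (Δ : ℝ) (M : ℕ → ℝ) : Prop :=
  ∃ c > (0 : ℝ), ∀ᶠ L : ℕ in atTop, ∀ [NeZero L], ∀ aN : TensorIndex (TorusSite 2 L) 2 → ℝ,
    IsPerronSectorGroundAmplitude L Δ (M L) aN → c ≤ condensateDensity aN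

/-- **LINK (PROVED).** Conjecture E + uniform density + existence of the reference Perron state along a
sequence of density `ρ_L → ρ ∈ (0,1)` ⇒ eventual condensation with the explicit floor `(ρ/2) e^{−K}`.
Theory seat memo ROTOR-THEORY-7 §84. [folklore] -/
theorem eventualCondensate_of_insertionEntropyBound (Δ : ℝ) (M : ℕ → ℝ) (ρ : ℝ)
    (hρ : ρ ∈ Set.Ioo (0 : ℝ) 1)
    (hlim : Tendsto (fun L : ℕ => 1 / 2 + M L / (L : ℝ) ^ 2) atTop (𝓝 ρ))
    (hE : InsertionEntropyBound Δ M) (hU : UniformSiteDensity Δ M) (hP : PerronSectorExists Δ M) :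
    EventualCondensate Δ M := by
  obtain ⟨K, hK⟩ := hE
  have hρ0 : 0 < ρ := hρ.1
  -- eventually the density is at least ρ/2
  have hhalf : ∀ᶠ L : ℕ in atTop, ρ / 2 ≤ 1 / 2 + M L / (L : ℝ) ^ 2 :=
    (hlim.eventually (eventually_ge_nhds (by linarith : ρ / 2 < ρ)))
  refine ⟨ρ / 2 * Real.exp (-K), by positivity, ?_⟩
  filter_upwards [hK, hU, hP, hhalf] with L hKL hUL hPL hhL
  intro _ aN haN
  obtain ⟨aM, haM⟩ := hPL
  have hdpos : 0 < 1 / 2 + M L / (L : ℝ) ^ 2 := lt_of_lt_of_le (by positivity) hhL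
  have main := condensateDensity_ge_of_entropy aM aN (1 / 2 + M L / (L : ℝ) ^ 2) K hdpos
    haM.nonneg haN.nonneg haM.unit (hUL aN haN) (fun x => (hKL aN aM haN haM x).1)
    (fun x => (hKL aN aM haN haM x).2)
  exact le_trans (mul_le_mul_of_nonneg_right hhL (le_of_lt (Real.exp_pos _))) main

/-- **CONJECTURE ENT-VT (typed record; ED 292/292 monotone series over 59 cases, memo §86 (vi)).**  On the torus the insertion
entropy is non-increasing in the anisotropy: for `-1 < Δ ≤ Δ' ≤ 1` and Perron sector amplitudes at `Δ`
and at `Δ'` (same sectors), `KL(ν_x[aN'] ‖ π[aM']) ≤ KL(ν_x[aN] ‖ π[aM])`; equivalently the tower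
overlap `BC²` and the condensate fraction `n₀/ρ` are non-decreasing in `Δ`.  Same status as the
`M_Δ` monotonicity family of memo-5 (vertex-transitivity essential; no FKG proof).
[conjecture: theory seat hubbard-h0-rotor-theory-1, cycle 7, 2026-08-28 — memo ROTOR-THEORY-7 §86 (vi), ED 292/292] -/
def InsertionEntropyMonotone (L : ℕ) [NeZero L] (M : ℝ) : Prop :=
  ∀ Δ Δ' : ℝ, -1 < Δ → Δ ≤ Δ' → Δ' ≤ 1 →
    ∀ aN aM aN' aM' : TensorIndex (TorusSite 2 L) 2 → ℝ,
      IsPerronSectorGroundAmplitude L Δ M aN → IsPerronSectorGroundAmplitude L Δ (M - 1) aM →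
      IsPerronSectorGroundAmplitude L Δ' M aN' → IsPerronSectorGroundAmplitude L Δ' (M - 1) aM' →
        ∀ x : TorusSite 2 L,
          klDiv (holeLaw aN' x) (bornLaw aM') ≤ klDiv (holeLaw aN x) (bornLaw aM)

/-- **NEGATIVE SIDE, d = 1 (typed record; ED rings L = 8…24, memo §86 (v)).**  On rings the insertion
entropy diverges along every sequence of densities bounded away from `0` and `1`: for every `K` it
eventually exceeds `K` (ED: `KL_int ≈ log L` at half filling, the free-fermion RPA value).  With the
E-FLOOR chain read backwards this is consistent with (not implied by) the absence of BEC in `d = 1`.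
[conjecture: theory seat hubbard-h0-rotor-theory-1, cycle 7, 2026-08-28 — memo ROTOR-THEORY-7 §86 (v), ED rings L = 8…24] -/
def RingInsertionEntropyDiverges (Δ : ℝ) (M : ℕ → ℝ) : Prop :=
  ∀ K : ℝ, ∀ᶠ L : ℕ in atTop, ∀ [NeZero L],
    ∀ aN aM : TensorIndex (TorusSite 1 L) 2 → ℝ,
      (∀ σ, 0 ≤ aN σ) → (∀ σ, 0 ≤ aM σ) → (∑ σ, aM σ ^ 2 = 1) →
      (xxzHamiltonian 1 (torusGraph 1 L) (-1) Δ).mulVec (fun σ => (aN σ : ℂ))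
        = ((lowestEnergyInSector 1 (xxzHamiltonian 1 (torusGraph 1 L) (-1) Δ) (M L) : ℝ) : ℂ)
            • (fun σ => (aN σ : ℂ)) →
      (fun σ => (aN σ : ℂ)) ∈ spinZSector (Λ := TorusSite 1 L) 1 (M L) →
      (xxzHamiltonian 1 (torusGraph 1 L) (-1) Δ).mulVec (fun σ => (aM σ : ℂ))
        = ((lowestEnergyInSector 1 (xxzHamiltonian 1 (torusGraph 1 L) (-1) Δ) (M L - 1) : ℝ) : ℂ)
            • (fun σ => (aM σ : ℂ)) →
      (fun σ => (aM σ : ℂ)) ∈ spinZSector (Λ := TorusSite 1 L) 1 (M L - 1) →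
        ∀ x : TorusSite 1 L, K ≤ klDiv (holeLaw aN x) (bornLaw aM)

end Crux

end Summit.HubbardSuperconductivity.HubbardSuperconductivity.Theorems.AnisotropyChord.InsertionEntropy
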